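import Literature.AlgebraicGeometry.Morphisms.ProjectiveSubschemeCutOutByTwistEquations
import Mathlib.RingTheory.Polynomial.Basic
import HarnessLib

/-!
# ANY closed subscheme of `ℙ^r_A` (`A` Noetherian) is the vanishing locus of its degree-`d` equations for `d ≫ 0`, read in `𝒪(d)`

Topic `Literature/AlgebraicGeometry/Morphisms`, namespace `Literature.AlgebraicGeometry.Morphisms.ProjCech`.  THEOREMS ONLY (no definition, no
instance, no notation, no named fact, no `sorry`).  Cell `hodgecm-mathlib` (D-0151 ∕ FLOOR 0), P1 sub-line F-4 layer 2, sub-stub (II-b) (the Hom-SCHEME),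
brick **(b1)** «a family of closed subschemes CONTAINED IN A FIXED closed `W` is a CLOSED condition» of B-p20 (g14)'s census `CENSUS-F4-IIb-HomScheme`
(road (i′)), FIRST FILE: the generalisation of ★ `ProjectiveSubschemeCutOutByDegreeEquations` (FILE 3) ∕ ★ `ProjectiveSubschemeCutOutByTwistEquations`
(FILE 4) from «closed subscheme of `ℙ^r_k` with Hilbert polynomial `QZ`, `d ≥ B(QZ)`» to «ANY closed subscheme `X₀ ⊂ ℙ^r_A`, `d ≥` the degrees of a
finite generating set of its homogeneous ideal» (so: every `d ≫ 0` when `A` is Noetherian).  Count-neutral Mathlib-side capital: HC_CM is proved only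
modulo the 7 printed citations until rung 0 closes — nothing here is about HC.

THE PRINT.  [Hartshorne1977] II Cor. 5.16 (a) (p. 119) with II Prop. 5.9 and Ex. 5.10 (p. 125): a closed subscheme `X₀ ⊂ ℙ^r_A` is `Proj (P ⧸ 𝔞)` for its
(saturated) homogeneous ideal `𝔞 ⊆ P = A[x₀, …, x_r]`, and on the chart `D₊(x_j)` its ideal is `{f ∕ x_j^{deg f} : f ∈ 𝔞 homogeneous}`; if `𝔞` is generated by
forms of degree `≤ d` (e.g. `A` Noetherian, `d ≫ 0`) then `f ∕ x_j^{deg f} = (x_j^{d - deg f} f) ∕ x_j^d` shows that the degree-`d` part `𝔞_d` ALREADY cuts out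
`X₀` — [Kollar1996] I (1.6.2)–(1.10) ∕ [MumfordFogartyKirwan1994] Ch. 0 §5 (c) use this to make «sub-families contained in a fixed closed
subscheme» a closed condition on Hilbert schemes.  In the tree's currency (`𝔞 = idealZ ι`, `B_{{j}} = Bsub A r {j} = Γ(ℙ, D₊(x_j))`, `evalRing ι {j} : B_{{j}} →
Γ(X₀, X₀ ∩ D₊(x_j))`, `fracB A j d f = f_d ∕ x_j^d`):

* §1 (any ring `A`) `fracB_of_neg`, `fracB_eq_zero_of_totalDegree_lt` (bookkeeping); **`fracB_mem_span_fracB_of_mem_span`** — if `S ⊆ 𝔞` consists of polynomials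
  of total degree `≤ d`, every fraction `f_M ∕ x_j^M` of every `f ∈ (S)` lies in the ideal `⟨g_d ∕ x_j^d : g ∈ 𝔞⟩` of `B_{{j}}`;
  **`ker_evalRing_eq_span_fracB_of_totalDegree_le`** — hence, if such an `S` GENERATES `𝔞`, `ker (B_{{j}} → Γ(X₀, X₀ ∩ D₊(x_j))) = ⟨g_d ∕ x_j^d : g ∈ 𝔞⟩`
  (`ι` affine, e.g. a closed immersion); **`exists_forall_ker_evalRing_eq_span_fracB`** — for `A` NOETHERIAN this holds for all `d ≥ d₀(X₀)`;
* §2 (sheaf letter, `ι` a closed immersion) `ker_ideal_Dplus_eq_span_of_totalDegree_le` — the ideal SHEAF of `X₀` on `D₊(x_j)` is generated by the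
  `evalRing (𝟙 ℙ) {j} (g_d ∕ x_j^d)`; **`ker_eq_vanishingIdeal_transpose_of_totalDegree_le`** — for equations `v : K₀ ⟶ π_* 𝒪_ℙ(d)` over `Spec A` whose chart
  coordinates are exactly these functions (binders `hv`, `hv'` VERBATIM those of ★ FILE 4 `ker_eq_vanishingIdeal_transpose_of_hilbertPolynomial`), the ideal sheaf of
  `X₀` IS the vanishing ideal of `v♭ : π^* K₀ ⟶ 𝒪_ℙ(d)` — **`X₀ = V(v♭)`**; `…_of_isNoetherianRing` — the `∃ d₀, ∀ d ≥ d₀` packaging.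

## References
* [Hartshorne1977] R. Hartshorne, *Algebraic Geometry* (1977), II Prop. 5.9, Cor. 5.16 (a) (p. 119), Ex. 5.10 (p. 125), II Prop. 2.5 (b) (p. 76).
* [MumfordFogartyKirwan1994] D. Mumford, J. Fogarty, F. Kirwan, *Geometric Invariant Theory*, 3rd ed. (1994), Ch. 0 §5 (c) (p. 23).
* [Mumford1966CurvesSurface] D. Mumford, *Lectures on Curves on an Algebraic Surface* (1966), Lecture 15 (IV.)–(V.) (pp. 107–108) (the flat case).
-/

noncomputable section

-- `TopCat.Presheaf`/`Scheme.Modules` are not reducible (as in Mathlib's `AlgebraicGeometry/Modules`).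
set_option backward.isDefEq.respectTransparency false

universe u

-- needed to MENTION Mathlib's `Proj.awayToSection (grading A r)` / `Proj.basicOpenIsoAway` (as in ★ `Morphisms/CechH1Projective`, ★ FILE 4)
-- (re-cut B-typ03 (g19): no `attribute [local instance] MvPolynomial.gradedAlgebra`; the grading is supplied inline by `letI`, pattern ★ `Motives/ChowZeroSupportedOnHyperplaneSectionOfDegreeLE`)

open CategoryTheory CategoryTheory.Limits AlgebraicGeometry TopologicalSpace Opposite Polynomial
open Literature.Algebra.Homology Literature.Algebra.Homology.LaurentCech
open Literature.AlgebraicGeometry.Modules Literature.AlgebraicGeometry.Modules.SerreTwist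

namespace Literature.AlgebraicGeometry.Morphisms

namespace ProjCech

/-! ## §1 Any ring: the chart ideal from a generating set of bounded degree -/

section AnyRing

variable {A : Type u} [CommRing A] {r : ℕ} {X₀ : Scheme.{u}} (ι : X₀ ⟶ PP A r)

/-- `k_b ∕ x_j^b = 0` for `b < 0` (there is no component of negative degree). [cite: Hartshorne1977, II Proposition 2.5 (b) (p. 76)] -/
theorem fracB_of_neg (j : Fin (r + 1)) {b : ℤ} (hb : b < 0) (k : P A r) : fracB A j b k = 0 := by
  apply Subtype.ext
  change fracL A j b k = 0
  rw [fracL, hcomp_of_neg hb, map_zero, zero_mul]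

/-- `k_b ∕ x_j^b = 0` for `b > deg k` (Mathlib `MvPolynomial.homogeneousComponent_eq_zero`). [cite: Hartshorne1977, II Proposition 2.5 (b) (p. 76)] -/
theorem fracB_eq_zero_of_totalDegree_lt (j : Fin (r + 1)) {n : ℕ} {k : P A r} (h : k.totalDegree < n) :
    fracB A j (n : ℤ) k = 0 := by
  apply Subtype.ext
  change fracL A j n k = 0
  rw [fracL, hcomp_natCast, MvPolynomial.homogeneousComponent_eq_zero _ _ h, map_zero, zero_mul]

/-- **Fractions of the ideal generated by forms of degree `≤ d` lie in `⟨g_d ∕ x_j^d : g ∈ 𝔞⟩`**: if `S ⊆ 𝔞 = idealZ ι` consists of polynomials of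
total degree `≤ d`, then for every `f` in the ideal `(S)` and every `M`, `f_M ∕ x_j^M ∈ ⟨g_d ∕ x_j^d : g ∈ 𝔞⟩ ⊆ B_{{j}}` — on generators `g ∈ S`:
`g_M ∕ x_j^M = (x_j^{d-M} g)_d ∕ x_j^d` for `M ≤ d` (★ `fracB_X_pow_mul`) and `= 0` for `M > d ≥ deg g`; products by ★ `fracB_mul`.
[cite: Hartshorne1977, II Prop. 5.9 and Cor. 5.16 (a) (p. 119)] -/
theorem fracB_mem_span_fracB_of_mem_span {S : Set (P A r)} (hS : ∀ g ∈ S, g ∈ idealZ ι) {d : ℕ}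
    (hSd : ∀ g ∈ S, g.totalDegree ≤ d) (j : Fin (r + 1)) {f : P A r} (hf : f ∈ Ideal.span S) (M : ℤ) :
    fracB A j M f ∈ Ideal.span (Set.range fun g : idealZ ι => fracB A j d (g : P A r)) := by
  induction hf using Submodule.span_induction generalizing M with
  | mem g hg =>
    rcases lt_or_ge M 0 with hM | hM
    · rw [fracB_of_neg j hM]
      exact Ideal.zero_mem _
    · obtain ⟨n, rfl⟩ := Int.eq_ofNat_of_zero_le hM
      rcases le_or_gt n d with hnd | hnd
      · -- `g_n ∕ x_j^n = (x_j^{d-n} g)_d ∕ x_j^d`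
        have h : fracB A j (d : ℤ) (MvPolynomial.X j ^ (d - n) * g) = fracB A j (n : ℤ) g := by
          have e : (n : ℤ) + ((d - n : ℕ) : ℤ) = (d : ℤ) := by omega
          rw [← e]
          exact fracB_X_pow_mul j (d - n) (n : ℤ) g
        rw [← h]
        exact Ideal.subset_span ⟨⟨_, Ideal.mul_mem_left _ _ (hS g hg)⟩, rfl⟩
      · rw [fracB_eq_zero_of_totalDegree_lt j ((hSd g hg).trans_lt hnd)]
        exact Ideal.zero_mem _
  | zero => rw [fracB_zero]; exact Ideal.zero_mem _
  | add f f' _ _ hf hf' => rw [fracB_add]; exact Ideal.add_mem _ (hf M) (hf' M)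
  | smul a f _ hf =>
    rw [smul_eq_mul, fracB_mul]
    exact Ideal.sum_mem _ fun c _ => Ideal.mul_mem_left _ _ (hf c)

/-- **If `𝔞` is generated by forms of degree `≤ d`, the ideal of `X₀` on the chart `D₊(x_j)` is generated by the dehomogenised degree-`d` forms**:
`ker (B_{{j}} → Γ(X₀, X₀ ∩ D₊(x_j))) = ⟨g_d ∕ x_j^d : g ∈ 𝔞⟩` (`ι` affine, e.g. a closed immersion; no Hilbert-polynomial hypothesis, cf. ★
`ker_evalRing_eq_span_fracB_of_hilbertPolynomial`).  `⊇` is the definition of `𝔞`; for `⊆`, a fraction in the kernel is `f_N ∕ x_j^N` with `f ∈ 𝔞` (★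
`exists_mem_idealZ_of_evalRing_eq_zero`, ★ `eq_fracB_of_xs_mul_eq`) and `fracB_mem_span_fracB_of_mem_span` applies.
[cite: Hartshorne1977, II Prop. 5.9 and Cor. 5.16 (a) (p. 119)] -/
theorem ker_evalRing_eq_span_fracB_of_totalDegree_le [IsAffineHom ι] {S : Set (P A r)} (hS : Ideal.span S = idealZ ι)
    {d : ℕ} (hSd : ∀ g ∈ S, g.totalDegree ≤ d) (j : Fin (r + 1)) :
    RingHom.ker (evalRing ι {j}) = Ideal.span (Set.range fun g : idealZ ι => fracB A j d (g : P A r)) := by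
  apply le_antisymm
  · intro x hx
    obtain ⟨N, f, hf, hxf⟩ := exists_mem_idealZ_of_evalRing_eq_zero ι ((RingHom.mem_ker).1 hx)
    rw [eq_fracB_of_xs_mul_eq j hxf]
    rw [← hS] at hf
    exact fracB_mem_span_fracB_of_mem_span ι (fun g hg => hS ▸ Ideal.subset_span hg) hSd j hf N
  · rw [Ideal.span_le]
    rintro _ ⟨g, rfl⟩
    exact fracB_mem_ker_evalRing ι g.2 j d

/-- **For `A` Noetherian, the chart ideals of ANY closed subscheme of `ℙ^r_A` are generated by its dehomogenised degree-`d` forms for all `d ≫ 0`**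
(`P = A[x₀,…,x_r]` is Noetherian, so `𝔞` is generated by finitely many polynomials; take `d₀` = the maximum of their degrees).
[cite: Hartshorne1977, II Cor. 5.16 (a) (p. 119) and Ex. 5.10 (p. 125)] -/
theorem exists_forall_ker_evalRing_eq_span_fracB [IsAffineHom ι] [IsNoetherianRing A] :
    ∃ d₀ : ℕ, ∀ d : ℕ, d₀ ≤ d → ∀ j : Fin (r + 1),
      RingHom.ker (evalRing ι {j}) = Ideal.span (Set.range fun g : idealZ ι => fracB A j d (g : P A r)) := by
  obtain ⟨S, hS⟩ := (IsNoetherian.noetherian (idealZ ι) : (idealZ ι).FG)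
  refine ⟨S.sup MvPolynomial.totalDegree, fun d hd j => ?_⟩
  exact ker_evalRing_eq_span_fracB_of_totalDegree_le ι hS
    (fun g hg => (Finset.le_sup (f := MvPolynomial.totalDegree) hg).trans hd) j

end AnyRing

/-! ## §2 The sheaf letter: `X₀ = V(v♭)` for degree-`d` equations with the right chart coordinates -/

section Sheaf

variable {A : Type u} [CommRing A] {r : ℕ} {X₀ : Scheme.{u}} (ι : X₀ ⟶ PP A r) [IsClosedImmersion ι]

/-- **The ideal sheaf of `X₀ ⊂ ℙ^r_A` on `D₊(x_j)` is generated by the dehomogenised degree-`d` forms of its homogeneous ideal**, whenever `𝔞` is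
generated by polynomials of degree `≤ d` (★ `ker_ideal_Dplus_eq_map_ker_evalRing` + §1, moved into `Γ(ℙ, D₊(x_j))` by `evalRing (𝟙 ℙ) {j}`).
[cite: Hartshorne1977, II Cor. 5.16 (a) (p. 119)] -/
theorem ker_ideal_Dplus_eq_span_of_totalDegree_le {S : Set (P A r)} (hS : Ideal.span S = idealZ ι) {d : ℕ}
    (hSd : ∀ g ∈ S, g.totalDegree ≤ d) (j : Fin (r + 1)) :
    ι.ker.ideal ⟨Dplus A r {j}, isAffineOpen_Zop (𝟙 (PP A r)) (Finset.singleton_nonempty j)⟩ =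
      Ideal.span (Set.range fun f : idealZ ι =>
        show Γ(PP A r, Dplus A r {j}) from evalRing (𝟙 (PP A r)) {j} (fracB A j d (f : P A r))) := by
  rw [ker_ideal_Dplus_eq_map_ker_evalRing, ker_evalRing_eq_span_fracB_of_totalDegree_le ι hS hSd j, Ideal.map_span,
    ← Set.range_comp]
  rfl

variable {K₀ : (Spec (CommRingCat.of A)).Modules} (d : ℕ)
  (v : K₀ ⟶ (Scheme.Modules.pushforward (toSpec A r)).obj (twistMod (𝟙 (PP A r)) (unitModule (PP A r)) d))

/-- **ANY CLOSED SUBSCHEME OF `ℙ^r_A` IS THE VANISHING LOCUS OF ITS DEGREE-`d` EQUATIONS, `d` ≥ the degrees of a generating set of its homogeneous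
ideal** (sheaf letter; the non-flat, any-ring twin of ★ `ker_eq_vanishingIdeal_transpose_of_hilbertPolynomial`): let `v : K₀ ⟶ π_* 𝒪_ℙ(d)`
(`π : ℙ^r_A → Spec A`, `𝒪_ℙ(d)` the twist model along `𝟙 ℙ`) be equations whose `j`-coordinates on every chart `D₊(x_j)` are exactly the dehomogenised
degree-`d` forms of `𝔞 = idealZ ι` (`hv`, `hv'`, VERBATIM the binders of ★ FILE 4).  Then the ideal sheaf of `ι : X₀ ↪ ℙ^r_A` IS the vanishing ideal
of the transposed equations `v♭ : π^* K₀ ⟶ 𝒪_ℙ(d)` — both have, on every `D₊(x_j)`, the ideal generated by these functions (§2 and ★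
`vanishingIdeal_transpose_ideal_Zop_eq_span`). [cite: Hartshorne1977, II Cor. 5.16 (a) (p. 119) and Ex. 5.10 (p. 125)]
[cite: MumfordFogartyKirwan1994, Ch. 0 §5 (c) (p. 23)] -/
theorem ker_eq_vanishingIdeal_transpose_of_totalDegree_le {S : Set (P A r)} (hS : Ideal.span S = idealZ ι)
    (hSd : ∀ g ∈ S, g.totalDegree ≤ d) (hK : IsAffineLocalizing K₀)
    (hv : ∀ (x : Γ(K₀, ⊤)) (j : Fin (r + 1)), ∃ f ∈ idealZ ι,
      chartEquiv (𝟙 (PP A r)) (unitModule (PP A r)) d (le_refl (Zop (𝟙 (PP A r)) {j}))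
          ((twistMod (𝟙 (PP A r)) (unitModule (PP A r)) d).presheaf.map
            (homOfLE (le_top : Zop (𝟙 (PP A r)) {j} ≤ toSpec A r ⁻¹ᵁ ⊤)).op
            (show Γ(twistMod (𝟙 (PP A r)) (unitModule (PP A r)) d, toSpec A r ⁻¹ᵁ ⊤) from v.app ⊤ x)) =
        evalRing (𝟙 (PP A r)) {j} (fracB A j d f))
    (hv' : ∀ f ∈ idealZ ι, ∀ j : Fin (r + 1), ∃ x : Γ(K₀, ⊤),
      chartEquiv (𝟙 (PP A r)) (unitModule (PP A r)) d (le_refl (Zop (𝟙 (PP A r)) {j}))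
          ((twistMod (𝟙 (PP A r)) (unitModule (PP A r)) d).presheaf.map
            (homOfLE (le_top : Zop (𝟙 (PP A r)) {j} ≤ toSpec A r ⁻¹ᵁ ⊤)).op
            (show Γ(twistMod (𝟙 (PP A r)) (unitModule (PP A r)) d, toSpec A r ⁻¹ᵁ ⊤) from v.app ⊤ x)) =
        evalRing (𝟙 (PP A r)) {j} (fracB A j d f)) :
    ι.ker = vanishingIdeal (((Scheme.Modules.pullbackPushforwardAdjunction (toSpec A r)).homEquiv K₀ _).symm v) := by
  refine Scheme.IdealSheafData.ext_of_iSup_eq_top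
    (fun j : Fin (r + 1) => (⟨Dplus A r {j}, isAffineOpen_Zop (𝟙 (PP A r)) (Finset.singleton_nonempty j)⟩ : (PP A r).affineOpens))
    (iSup_cover_eq_top (𝟙 (PP A r))) fun j => ?_
  rw [ker_ideal_Dplus_eq_span_of_totalDegree_le ι hS hSd j]
  change _ = (vanishingIdeal _).ideal ⟨Zop (𝟙 (PP A r)) {j}, isAffineOpen_Zop (𝟙 (PP A r)) (Finset.singleton_nonempty j)⟩
  rw [vanishingIdeal_transpose_ideal_Zop_eq_span (𝟙 (PP A r)) (toSpec A r) d v hK j]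
  apply le_antisymm
  · rw [Ideal.span_le]
    rintro _ ⟨f, rfl⟩
    obtain ⟨x, hx⟩ := hv' f f.2 j
    exact Ideal.subset_span ⟨x, hx⟩
  · rw [Ideal.span_le]
    rintro _ ⟨x, rfl⟩
    obtain ⟨f, hf, hx⟩ := hv x j
    exact Ideal.subset_span ⟨⟨f, hf⟩, hx.symm⟩

/-- **The same for `A` Noetherian and every `d ≫ 0`**: there is `d₀` such that for every `d ≥ d₀` and every system of degree-`d` equations `v` with the
chart coordinates of `𝔞` (binders as above), `𝓘_{X₀} = V(v♭)`. [cite: Hartshorne1977, II Cor. 5.16 (a) (p. 119) and Ex. 5.10 (p. 125)] -/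
theorem exists_forall_ker_eq_vanishingIdeal_transpose [IsNoetherianRing A] :
    ∃ d₀ : ℕ, ∀ d : ℕ, d₀ ≤ d → ∀ ⦃K₀ : (Spec (CommRingCat.of A)).Modules⦄ (_ : IsAffineLocalizing K₀)
      (v : K₀ ⟶ (Scheme.Modules.pushforward (toSpec A r)).obj (twistMod (𝟙 (PP A r)) (unitModule (PP A r)) d)),
      (∀ (x : Γ(K₀, ⊤)) (j : Fin (r + 1)), ∃ f ∈ idealZ ι,
        chartEquiv (𝟙 (PP A r)) (unitModule (PP A r)) d (le_refl (Zop (𝟙 (PP A r)) {j}))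
            ((twistMod (𝟙 (PP A r)) (unitModule (PP A r)) d).presheaf.map
              (homOfLE (le_top : Zop (𝟙 (PP A r)) {j} ≤ toSpec A r ⁻¹ᵁ ⊤)).op
              (show Γ(twistMod (𝟙 (PP A r)) (unitModule (PP A r)) d, toSpec A r ⁻¹ᵁ ⊤) from v.app ⊤ x)) =
          evalRing (𝟙 (PP A r)) {j} (fracB A j d f)) →
      (∀ f ∈ idealZ ι, ∀ j : Fin (r + 1), ∃ x : Γ(K₀, ⊤),
        chartEquiv (𝟙 (PP A r)) (unitModule (PP A r)) d (le_refl (Zop (𝟙 (PP A r)) {j}))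
            ((twistMod (𝟙 (PP A r)) (unitModule (PP A r)) d).presheaf.map
              (homOfLE (le_top : Zop (𝟙 (PP A r)) {j} ≤ toSpec A r ⁻¹ᵁ ⊤)).op
              (show Γ(twistMod (𝟙 (PP A r)) (unitModule (PP A r)) d, toSpec A r ⁻¹ᵁ ⊤) from v.app ⊤ x)) =
          evalRing (𝟙 (PP A r)) {j} (fracB A j d f)) →
      ι.ker = vanishingIdeal (((Scheme.Modules.pullbackPushforwardAdjunction (toSpec A r)).homEquiv K₀ _).symm v) := by
  obtain ⟨S, hS⟩ := (IsNoetherian.noetherian (idealZ ι) : (idealZ ι).FG)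
  refine ⟨S.sup MvPolynomial.totalDegree, fun d hd K₀ hK v hv hv' => ?_⟩
  exact ker_eq_vanishingIdeal_transpose_of_totalDegree_le ι d v hS
    (fun g hg => (Finset.le_sup (f := MvPolynomial.totalDegree) hg).trans hd) hK hv hv'

end Sheaf

end ProjCech

end Literature.AlgebraicGeometry.Morphisms

end
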